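import Summits.ABC.IUTFork.Repair.CandInternal7
import Summits.ABC.IUTFork.Repair.CandInternal22
import Summits.ABC.IUTFork.Repair.ObstructionSS6Witness
import HarnessLib

/-!
# IUT REPAIR branch (rung LADDER-ABC:A2.RP), sub-cell B0 class (i) INTERNAL, file `CandInternal31` (abc-iut-rp-d1, gen 2): (§1) with the
# link-action binder `Λ` quantified away, RP-I07's supplier IS print's datum clause `PilotKummerCompat` (model-free, under typed Thm. 3.11);
# (§2–3) the d1 rows on the PINNED SCAL BASE OF RECORD `sFull₀` / abc-iut-rp-s3's door-(b) witness `wSetting` (RULINGS #24 (1)), incl. RP-I14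

Proof-only record file (D-0012; 0 definitions, 0 `Prop` facts, standard axioms) of the abc-iut cell's IUT REPAIR branch (human ruling D-0077(2);
director-abc MINT 2026-08-26T05:11:35Z + ERRATUM 05:12:15Z; seat abc-iut-rp-d1, k = 31 ≡ 1 (mod 3)). TAKES NO SIDE on [IUTchIII] Cor. 3.12 or on
any author; candidates stay hypotheses; typed ≠ proved; instantiated ≠ endorsed. Sequel of `CandInternal22` (p433240) / `CandInternal25` (p433850) /
`CandInternal28` (p434718). Consumed BY NAME: abc-iut-w4-d098's `ScalarShellsThm311Zero.sFull₀` (the scaling shells with the zero region admissible —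
the SCAL base of record) and abc-iut-rp-s3's pinned door-(b) witness `ObstructionSS6Witness.wSetting p` / `wRho p` over it (p432775: three pins,
honest `j²`-scaling, S holds through `sFamDep (cQ p) ∈ ⟨(Ind1)∪(Ind2)⟩`, and the PRICE `¬ThetaFinite ∧ ¬Statement ∧ ¬BridgeHyps`).

## RESULTS (kernel, this file)
* **§1 `exists_coric_H7_and_link_iff` (model-free).** Under typed Thm. 3.11 (i) `MultiradialCompat` and (ii)(b) `KummerB` at `n−1`, `n`:
  «∃ coric `Λ ⊆ ⟨(Ind1)∪(Ind2)⟩` with RP-I07's `H Λ` ∧ (L)`Λ`» ⟺ `PilotKummerCompat` — and ANY `Λ` with `H Λ ∧ (L) Λ` already gives `PilotKummerCompat`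
  (`CandInternal7.pilotKummerCompat_of_H_of_link`). So, exactly as for RP-I03a/RP-I13 (`CandInternal10.exists_H_and_linkTransport_iff`), with the
  binder quantified away the two-column class-(i) supplier collapses to print's datum clause (BAR-V / REPAIRED⁰ ceiling); what RP-I07 adds is the
  READING of `Λ`, whose bed-dependence `CandInternal25`/`CandInternal28` record.
* **§2 `scal₀_cells`** — the SCAL cells of `CandInternal22 §3` / `CandInternal25 §3` restated over the base of record `sFull₀ p` (every setting, every
  `ρ`; same proofs: the columns carry `Ψ_v`, `sFull₀_D_frobΨ`): RP-I13 / RP-I03a `H` / RF1 / RP-I07 `H` / (L) HOLD for the transporting (Ind2)-family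
  `{sFamDep (cQ p)}`, RP-I03b `Hins ⟨Ind2⟩` FAILS, `PilotKummerCompat` and S hold.
* **§2 `candInternal13H_scal₀_of_mem` — RP-I14 at SCAL: the transporting (Ind2)-family is RADIAL** (it intertwines the coordinatewise action of the
  theta-value tuple `(q^{j²})_j` into that of its transport `(q)_j`): so at SCAL, as at P♮⁺ (`CandInternal22.coric_transport_radial_at_natAct`), ONE
  family is coric ∧ transporting ∧ radial — the CM exclusivity (`CandInternal13.not_radial_and_coric_at_pinned`) is absent on both S-beds.
* **§3 `wSetting_d1_rows`** — at abc-iut-rp-s3's PINNED door-(b) witness: three pins ∧ S ∧ the d1 cells above ∧ the price (`¬ThetaFinite`,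
  `¬Statement`, `¬BridgeHyps`): the class-(i) supplier's conjuncts all hold where S holds at honest `j²`-volumes — and the Statement fails there
  (grade SAT⊖[BridgeHyps], REPAIR-SPEC §3), no side taken on whether print's (Ind2) is isometric.
-/

noncomputable section

open Set

namespace Summit.ABC.IUTFork.Repair

open Thm311 Cor312 Cor312Vol Literature.IUT.LogThetaLattice

namespace CandInternal31

/-! ## 1. Model-free: with `Λ` bound, RP-I07's supplier is `PilotKummerCompat` -/

section General

variable {T : ThetaIndex} (S : LatticeSituation T) (P : Cor312.Setting S.toSituation)
  (qK : ∀ v : T.V, v ∈ T.Vbad → Set (S.L.StarPacket v))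

/-- **`exists_coric_H7_and_link_iff`.** Under Thm. 3.11 (i) `MultiradialCompat` and (ii)(b) `KummerB` at the columns `n−1`, `n`: there is a coric
link-action binder `Λ ⊆ ⟨(Ind1)∪(Ind2)⟩` satisfying RP-I07's `H` together with abc-iut-w5-d155's transport (L) iff print's datum clause
`PilotKummerCompat` holds. (⇐: `Λ = {Φ·Φ₁⁻¹}` where `Φ` transports at column `n` and `Φ₁` relates the lines `n−1`, `n`.) [claim: Mochizuki2012, status: disputed] -/
theorem exists_coric_H7_and_link_iff (hMR : S.MultiradialCompat) (hKumB' : (S.col (P.n - 1)).KummerB (S.D (P.n - 1)))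
    (hKumB : (S.col P.n).KummerB (S.D P.n)) :
    (∃ Λ : Set S.L.PacketAut, Λ ⊆ (Subgroup.closure (S.L.Ind1Family ∪ S.L.Ind2Family) : Set S.L.PacketAut) ∧
        CandInternal7.H S P Λ ∧
        ∃ Φ₀ ∈ Λ, ∃ m₀ : ℤ, ∀ (v : T.V) (hv : v ∈ T.Vbad), qK v hv = S.L.starAut Φ₀ v '' (S.col (P.n - 1)).frobΨ m₀ v hv) ↔
      PilotKummerCompat S P qK := by
  constructor
  · rintro ⟨Λ, -, h7, hL⟩
    exact CandInternal7.pilotKummerCompat_of_H_of_link S P qK Λ h7 hL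
  · rintro ⟨Φ, hΦ, m, hq⟩
    obtain ⟨Φ₁, hΦ₁, hΨ⟩ :=
      GluedMonoids.exists_closure_psi_eq_of_mem_RLGP (L := S.L) (S.mem_RLGP_of_multiradialCompat hMR P.n (P.n - 1))
    have hmem : Φ * Φ₁⁻¹ ∈ Subgroup.closure (S.L.Ind1Family ∪ S.L.Ind2Family) := mul_mem hΦ (inv_mem hΦ₁)
    refine ⟨{Φ * Φ₁⁻¹}, by rintro _ rfl; exact hmem,
      CandInternal7.H_of_linkSubInd S P _ hMR hKumB' hKumB (by rintro _ rfl; exact hmem), Φ * Φ₁⁻¹, rfl, 0, fun v hv => ?_⟩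
    rw [hq v hv, hKumB m v hv, hKumB' 0 v hv, hΨ v hv, ← PinnedLink.starAut_mul_image, mul_assoc, inv_mul_cancel, mul_one]

/-- Without the coric restriction the forward direction still holds: ANY binder with `H Λ ∧ (L) Λ` gives `PilotKummerCompat` (so the coric ones
are exactly as strong as all of them, once typed Thm. 3.11 holds). [folklore] -/
theorem exists_H7_and_link_iff (hMR : S.MultiradialCompat) (hKumB' : (S.col (P.n - 1)).KummerB (S.D (P.n - 1)))
    (hKumB : (S.col P.n).KummerB (S.D P.n)) :
    (∃ Λ : Set S.L.PacketAut, CandInternal7.H S P Λ ∧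
        ∃ Φ₀ ∈ Λ, ∃ m₀ : ℤ, ∀ (v : T.V) (hv : v ∈ T.Vbad), qK v hv = S.L.starAut Φ₀ v '' (S.col (P.n - 1)).frobΨ m₀ v hv) ↔
      PilotKummerCompat S P qK := by
  constructor
  · rintro ⟨Λ, h7, hL⟩
    exact CandInternal7.pilotKummerCompat_of_H_of_link S P qK Λ h7 hL
  · intro h
    obtain ⟨Λ, -, h7, hL⟩ := (exists_coric_H7_and_link_iff S P qK hMR hKumB' hKumB).2 h
    exact ⟨Λ, h7, hL⟩

end General

/-! ## 2. The d1 rows over the SCAL base of record `sFull₀` (abc-iut-w4-d098) -/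

section Scal

open Cor312.Checks Cor312.IdentifiedNonVacuity NaiveWitness PinnedWitness
  Summit.ABC.IUTFork.Repair.ScalarShells Summit.ABC.IUTFork.Repair.ScalarShellsThm311 Summit.ABC.IUTFork.Repair.ScalarShellsThm311Zero

variable (p : ℕ) [hp : Fact p.Prime]

omit hp in
/-- Over `sFull₀ p` every column Kummer image of the Θ-pilot splitting monoid is `Ψ_v` (abc-iut-w4-d098 `sFull₀_D_frobΨ`). [folklore] -/
theorem scal₀_frobΨ (n m : ℤ) (v : toyIndex.V) (hv : v ∈ toyIndex.Vbad) : ((sFull₀ p).toLatticeSituation.col n).frobΨ m v hv = Psi p v := by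
  rw [(sFull₀_D_frobΨ p n m).2.2]

/-- **RP-I03b over `sFull₀`: `Hins` FAILS for every `Λ ∋ sFamDep (cQ p)`**, for every setting. [folklore] -/
theorem not_Hins_scal₀_of_mem (P : Cor312.Setting (sFull₀ p).toLatticeSituation.toSituation) {Λ : Set (scalingShells p).PacketAut}
    (hΛ : sFamDep p (cQ p) ∈ Λ) : ¬ CandInternal1.Hins (sFull₀ p).toLatticeSituation P Λ := fun h => by
  obtain ⟨v, hv⟩ := toyIndex.Vbad_nonempty
  have h1 := h _ hΛ 0 v hv
  rw [scal₀_frobΨ] at h1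
  exact CandInternal22.cQ_Psi_ne p v hv h1

/-- … in particular `Hins ⟨Ind2⟩` FAILS over `sFull₀` (contrast CM). [folklore] -/
theorem not_Hins_scal₀_closure_Ind2 (P : Cor312.Setting (sFull₀ p).toLatticeSituation.toSituation) :
    ¬ CandInternal1.Hins (sFull₀ p).toLatticeSituation P
        (Subgroup.closure (scalingShells p).Ind2Family : Set (scalingShells p).PacketAut) :=
  not_Hins_scal₀_of_mem p P (Subgroup.subset_closure (sFamDep_mem_Ind2Family p (cQ p)))

/-- **RF1 and (L) HOLD over `sFull₀`** for the transporting (Ind2)-family and abc-iut-w4-d101's q-datum, at the columns `n` and `n−1`. [folklore] -/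
theorem transports_scal₀_cQ (P : Cor312.Setting (sFull₀ p).toLatticeSituation.toSituation) :
    (∃ Φ₀ ∈ ({sFamDep p (cQ p)} : Set (scalingShells p).PacketAut), ∃ m₀ : ℤ, ∀ (v : toyIndex.V) (hv : v ∈ toyIndex.Vbad),
      PinnedWitness.qDatum p v hv = (scalingShells p).starAut Φ₀ v '' ((sFull₀ p).toLatticeSituation.col P.n).frobΨ m₀ v hv) ∧
    (∃ Φ₀ ∈ ({sFamDep p (cQ p)} : Set (scalingShells p).PacketAut), ∃ m₀ : ℤ, ∀ (v : toyIndex.V) (hv : v ∈ toyIndex.Vbad),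
      PinnedWitness.qDatum p v hv = (scalingShells p).starAut Φ₀ v '' ((sFull₀ p).toLatticeSituation.col (P.n - 1)).frobΨ m₀ v hv) :=
  ⟨⟨sFamDep p (cQ p), rfl, 0, fun v hv => by rw [scal₀_frobΨ]; exact (starAut_cQ_Psi p v hv).symm⟩,
    ⟨sFamDep p (cQ p), rfl, 0, fun v hv => by rw [scal₀_frobΨ]; exact (starAut_cQ_Psi p v hv).symm⟩⟩

/-- **RP-I14 over `sFull₀` (honest coordinatewise action): the transporting (Ind2)-family is RADIAL** — `sFamDep (cQ p)` intertwines the action of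
the theta-value tuple `(q^{j²})_j ∈ Ψ_v` into that of its transport `(q)_j ∈ qDatum`; so RP-I14's `H` HOLDS for every `Λ ∋ sFamDep (cQ p)` and every
setting. [folklore] -/
theorem candInternal13H_scal₀_of_mem (P : Cor312.Setting (sFull₀ p).toLatticeSituation.toSituation) {Λ : Set (scalingShells p).PacketAut}
    (hΛ : sFamDep p (cQ p) ∈ Λ) : CandInternal13.H (sFull₀ p).toLatticeSituation P (PinnedWitness.qDatum p) Λ := by
  intro v hv
  have hκ : (scalingShells p).starAut (sFamDep p (cQ p)) v (thetaValues p v) ∈ PinnedWitness.qDatum p v hv := by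
    rw [← starAut_cQ_Psi p v hv]; exact ⟨thetaValues p v, thetaValues_mem_Psi p v, rfl⟩
  refine ⟨sFamDep p (cQ p), hΛ, 0, thetaValues p v, by rw [scal₀_frobΨ]; exact thetaValues_mem_Psi p v,
    (scalingShells p).starAut (sFamDep p (cQ p)) v (thetaValues p v), hκ, fun x => ?_⟩
  funext j
  -- `line` is abc-iut-w5-d247's coordinate on the (definitionally equal) sign-shell packets; scalar compatibility by defeq, not by `rw`
  have hsmul : ∀ (a : ℚ) (z : (scalingShells p).Packet j.1 (toyIndex.over v)),
      line j.1 (toyIndex.over v) (a • z) = a * line j.1 (toyIndex.over v) z := fun a z =>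
    LinearEquiv.map_smul (line j.1 (toyIndex.over v)) a z
  have e1 : line j.1 (toyIndex.over v)
      (sFamDep p (cQ p) j.1 (toyIndex.over v) ((line j.1 (toyIndex.over v) (thetaValues p v j)) • x j)) =
        ((cQ p j.1 : ℚˣ) : ℚ) ^ (((j.1 : toyIndex.Label) : ℕ) + 1) *
          (line j.1 (toyIndex.over v) (thetaValues p v j) * line j.1 (toyIndex.over v) (x j)) := by
    rw [line_sFamDep, hsmul]
  have e2 : line j.1 (toyIndex.over v)
      ((line j.1 (toyIndex.over v) (sFamDep p (cQ p) j.1 (toyIndex.over v) (thetaValues p v j))) • x j) =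
        ((cQ p j.1 : ℚˣ) : ℚ) ^ (((j.1 : toyIndex.Label) : ℕ) + 1) * line j.1 (toyIndex.over v) (thetaValues p v j) *
          line j.1 (toyIndex.over v) (x j) := by
    rw [hsmul, line_sFamDep]
  apply (line j.1 (toyIndex.over v)).injective
  show line j.1 (toyIndex.over v) (sFamDep p (cQ p) j.1 (toyIndex.over v) ((line j.1 (toyIndex.over v) (thetaValues p v j)) • x j)) =
    line j.1 (toyIndex.over v)
      ((line j.1 (toyIndex.over v) (sFamDep p (cQ p) j.1 (toyIndex.over v) (thetaValues p v j))) • x j)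
  rw [e1, e2]
  ring

/-- **`scal₀_cells` — the d1 rows over the SCAL base of record, packaged** (every setting `P` over `sFull₀ p`, every region operator `ρ`, q-datum
`qDatum p`, transporting family `Λ = {sFamDep (cQ p)}` ⊆ ⟨Ind2⟩): typed Thm 3.11; RP-I13 HOLDS; RP-I03a `H` HOLDS; RF1 HOLDS; RP-I03b `Hins` FAILS;
RP-I07 `H` HOLDS and (L) HOLDS; RP-I14 HOLDS (radial); `PilotKummerCompat`; S; and Step (x) log-volume invariance FAILS on the bed (door (b)).
[claim: Mochizuki2012, status: disputed] -/
theorem scal₀_cells (P : Cor312.Setting (sFull₀ p).toLatticeSituation.toSituation)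
    (ρ : (∀ v : toyIndex.V, v ∈ toyIndex.Vbad → Set ((scalingShells p).StarPacket v)) →
      ∀ (j : toyIndex.Label) (vQ : toyIndex.VQ), Set ((scalingShells p).Packet j vQ)) :
    (sFull₀ p).Statement ∧
      CandInternal10.H (sFull₀ p).toLatticeSituation {sFamDep p (cQ p)} ∧
      CandInternal1.H (sFull₀ p).toLatticeSituation P {sFamDep p (cQ p)} ∧
      (∃ Φ₀ ∈ ({sFamDep p (cQ p)} : Set (scalingShells p).PacketAut), ∃ m₀ : ℤ, ∀ (v : toyIndex.V) (hv : v ∈ toyIndex.Vbad),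
        PinnedWitness.qDatum p v hv = (scalingShells p).starAut Φ₀ v '' ((sFull₀ p).toLatticeSituation.col P.n).frobΨ m₀ v hv) ∧
      ¬ CandInternal1.Hins (sFull₀ p).toLatticeSituation P {sFamDep p (cQ p)} ∧
      CandInternal7.H (sFull₀ p).toLatticeSituation P {sFamDep p (cQ p)} ∧
      (∃ Φ₀ ∈ ({sFamDep p (cQ p)} : Set (scalingShells p).PacketAut), ∃ m₀ : ℤ, ∀ (v : toyIndex.V) (hv : v ∈ toyIndex.Vbad),
        PinnedWitness.qDatum p v hv = (scalingShells p).starAut Φ₀ v '' ((sFull₀ p).toLatticeSituation.col (P.n - 1)).frobΨ m₀ v hv) ∧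
      CandInternal13.H (sFull₀ p).toLatticeSituation P (PinnedWitness.qDatum p) {sFamDep p (cQ p)} ∧
      PilotKummerCompat (sFull₀ p).toLatticeSituation P (PinnedWitness.qDatum p) ∧
      PilotKummerIndRelated (sFull₀ p).toLatticeSituation P ρ (PinnedWitness.qDatum p) ∧
      (∀ (j : toyIndex.Label) (vQ : toyIndex.VQ) (k : ℤ),
        ∃ Φ ∈ Subgroup.closure ((scalingShells p).Ind1Family ∪ (scalingShells p).Ind2Family),
          (sData₀ p).Adm j vQ (sBall p ⊤ j vQ k) ∧
            (sData₀ p).logvol j vQ (Φ j vQ '' sBall p ⊤ j vQ k) ≠ (sData₀ p).logvol j vQ (sBall p ⊤ j vQ k)) := by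
  have hcoric : CandInternal10.H (sFull₀ p).toLatticeSituation {sFamDep p (cQ p)} := by
    rintro _ rfl; exact Subgroup.subset_closure (sFamDep_mem_Ind2Family p (cQ p))
  have hH : CandInternal1.H (sFull₀ p).toLatticeSituation P {sFamDep p (cQ p)} := CandInternal1.H_of_subset_closure_Ind2 _ _ _ hcoric
  have h7 : CandInternal7.H (sFull₀ p).toLatticeSituation P {sFamDep p (cQ p)} := fun Φ hΦ m =>
    ⟨Φ, CandInternal10.linkSubInd_of_H _ _ hcoric hΦ, 0, fun v hv => by rw [scal₀_frobΨ, scal₀_frobΨ]⟩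
  have hPKC : PilotKummerCompat (sFull₀ p).toLatticeSituation P (PinnedWitness.qDatum p) :=
    CandInternal1.pilotKummerCompat_of_H_of_linkTransport _ _ _ _ hH (transports_scal₀_cQ p P).1
  exact ⟨sFull₀_statement p, hcoric, hH, (transports_scal₀_cQ p P).1, not_Hins_scal₀_of_mem p P rfl, h7, (transports_scal₀_cQ p P).2,
    candInternal13H_scal₀_of_mem p P rfl, hPKC,
    pilotKummerIndRelated_of_pilotKummerCompat _ P ρ _ (sColumn₀_kummerB p P.n) hPKC, logvol_not_invariant₀ p⟩

end Scal

/-! ## 3. At abc-iut-rp-s3's PINNED door-(b) witness `wSetting` -/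

section Witness

open Cor312.Checks Cor312.IdentifiedNonVacuity NaiveWitness PinnedWitness
  Summit.ABC.IUTFork.Repair.ScalarShells Summit.ABC.IUTFork.Repair.ScalarShellsThm311 Summit.ABC.IUTFork.Repair.ScalarShellsThm311Zero
  Summit.ABC.IUTFork.Repair.ObstructionSS6Witness

variable (p : ℕ) [hp : Fact p.Prime]

/-- **`wSetting_d1_rows` — the d1 rows at the pinned SCAL witness of record** (`wSetting p`, operator `wRho p`, q-datum `qDatum p`, transporting
family `{sFamDep (cQ p)}`): the three pins HOLD, S HOLDS, RP-I13 / RP-I03a `H` / RF1 / RP-I07 `H` / (L) / RP-I14 HOLD, RP-I03b `Hins` FAILS,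
`PilotKummerCompat` HOLDS — and THE PRICE of the bed: `¬ThetaFinite`, the typed Statement FAILS, the bridge hypotheses FAIL (abc-iut-rp-s3
`wSetting_price`). Grade SAT⊖[BridgeHyps/ThetaFinite] in REPAIR-SPEC's words; no side taken. [claim: Mochizuki2012, status: disputed] -/
theorem wSetting_d1_rows :
    PinnedRegions3 (sFull₀ p).toLatticeSituation (wSetting p) (wRho p) (PinnedWitness.qDatum p) ∧
      PilotKummerIndRelated (sFull₀ p).toLatticeSituation (wSetting p) (wRho p) (PinnedWitness.qDatum p) ∧
      CandInternal10.H (sFull₀ p).toLatticeSituation {sFamDep p (cQ p)} ∧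
      CandInternal1.H (sFull₀ p).toLatticeSituation (wSetting p) {sFamDep p (cQ p)} ∧
      (∃ Φ₀ ∈ ({sFamDep p (cQ p)} : Set (scalingShells p).PacketAut), ∃ m₀ : ℤ, ∀ (v : toyIndex.V) (hv : v ∈ toyIndex.Vbad),
        PinnedWitness.qDatum p v hv =
          (scalingShells p).starAut Φ₀ v '' ((sFull₀ p).toLatticeSituation.col (wSetting p).n).frobΨ m₀ v hv) ∧
      ¬ CandInternal1.Hins (sFull₀ p).toLatticeSituation (wSetting p) {sFamDep p (cQ p)} ∧
      CandInternal7.H (sFull₀ p).toLatticeSituation (wSetting p) {sFamDep p (cQ p)} ∧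
      (∃ Φ₀ ∈ ({sFamDep p (cQ p)} : Set (scalingShells p).PacketAut), ∃ m₀ : ℤ, ∀ (v : toyIndex.V) (hv : v ∈ toyIndex.Vbad),
        PinnedWitness.qDatum p v hv =
          (scalingShells p).starAut Φ₀ v '' ((sFull₀ p).toLatticeSituation.col ((wSetting p).n - 1)).frobΨ m₀ v hv) ∧
      CandInternal13.H (sFull₀ p).toLatticeSituation (wSetting p) (PinnedWitness.qDatum p) {sFamDep p (cQ p)} ∧
      PilotKummerCompat (sFull₀ p).toLatticeSituation (wSetting p) (PinnedWitness.qDatum p) ∧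
      ¬ (wSetting p).ThetaFinite ∧ ¬ (wSetting p).Statement ∧ ¬ BridgeHyps (wSetting p) := by
  obtain ⟨-, hcoric, hH, hRF, hnins, h7, hL, hrad, hPKC, -, -⟩ := scal₀_cells p (wSetting p) (wRho p)
  exact ⟨wSetting_pinnedRegions3 p, wSetting_residual p, hcoric, hH, hRF, hnins, h7, hL, hrad, hPKC,
    (wSetting_price p).2.1, (wSetting_price p).2.2.1, (wSetting_price p).2.2.2⟩

end Witness

end CandInternal31

end Summit.ABC.IUTFork.Repair

end
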